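import Mathlib
import HarnessLib
import Summits.HubbardSuperconductivity.HubbardSuperconductivity.Theorems.KLProgrammeKLRegimeSplitGlueP3
import Summits.HubbardSuperconductivity.HubbardSuperconductivity.Theorems.KLProgrammeKLRegimeSplitBundleV7

/-!
# Route `KLProgramme` — the K3-NAMED glue of the five v3 children at the bundle `klPredsV7` (V6 + the two-leg volume rate (E3f), Δ14)
# (stmt-HubbardSuperconductivity-19937; DOWNSTREAM of the route file; cell gate-hubbard-kl, seat p2, g4)

`KLRegimeInductionV7P3 := KLRegimeInductionP3 klPredsV7 FinalTwoLegVolLimit` — the closer the resplit's glue item cites if the planner files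
the children at `klPredsV7`.  Nothing else is asserted.
-/

noncomputable section

namespace Summit.HubbardSuperconductivity.HubbardSuperconductivity.Theorems.KLRegimeSplit

set_option linter.dupNamespace false -- summit = problem name (single-conjunct summit), D-0017

/-- **The K3-named glue at `klPredsV7`** (V6 + (E3f), Δ14): the five V7 children of record imply crux K3 `KLRegimeTwoPointLimit` BY NAME. -/
theorem KLRegimeInductionV7P3 :
    EngineP3 klPredsV7 klWindowC → BetaSplitP klPredsV7 klWindowC → CountertermP2 klPredsV7 klWindowC →
      VolumeLimitP klPredsV7 FinalTwoLegVolLimit klWindowC → TwoPointAssemblyP3 klPredsV7 FinalTwoLegVolLimit klWindowC →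
        Summit.HubbardSuperconductivity.HubbardSuperconductivity.Theses.KLProgramme.KLRegimeTwoPointLimit :=
  KLRegimeInductionP3 klPredsV7 FinalTwoLegVolLimit

end Summit.HubbardSuperconductivity.HubbardSuperconductivity.Theorems.KLRegimeSplit

end
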